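import Summits.HodgeConjecture.HodgeConjecture.Theorems.F0P6aRoofWCountsTop
import HarnessLib

/-!
# `F0P6aRoofWCounts` — ★ RE-HOME of `Lines/F0_P6a_RoofWCounts.lean` (tree ED. 2 sha16 19385c8201dbcf3d), PART 2 of 2 — tree lines :383–:564 (LAST part: the module the `Lines/` shim and consumers import; it transitively carries parts 1–1).

See PART 1 `Theorems/F0P6aRoofWCountsTop.lean` for the full ★ re-home header and the original module docstring (verbatim there).  Same namespace (every fully-qualified name unchanged);
the scopes open at the cut (`noncomputable section` ∕ `namespace` ∕ `section`s) are re-opened below with their `variable` ∕ `open` ∕ `set_option` ∕ `omit` ∕ `include` ∕ `universe` lines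
replayed verbatim from the tree, in order; the code after the replay block is the tree bytes :383–:564, untouched.  HC_CM is proved only modulo the 7 printed citations (2 remaining: hLiu418 = stmt-HodgeConjecture-24832, h413 = stmt-HodgeConjecture-24833) until rung 0 closes; a re-home is count-neutral.
-/

-- ── replay of the scopes open at tree line :383 (verbatim) ──
set_option autoImplicit false
set_option linter.dupNamespace false
set_option backward.isDefEq.respectTransparency false
noncomputable section
namespace Summit.HodgeConjecture.HodgeConjecture.Cruxes.HLiu418.F0P6aRoofWCounts
open CategoryTheory CategoryTheory.Limits AlgebraicGeometry NumberField IsDedekindDomain MulAction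
open MonoidalCategory CartesianMonoidalCategory
open scoped Matrix Pointwise MonObj CategoryTheory.Obj
open Literature.NumberTheory.GaloisRepresentations
open Literature.NumberTheory.Automorphic Literature.NumberTheory.Automorphic.UnitaryGroup
open Literature.AlgebraicGeometry.ShimuraVarieties.UnitaryCanonicalModel
open Literature.NumberTheory.Automorphic.Liu2021.AppendixC
open Literature.AlgebraicGeometry.Motives (AlgPoints IntegralModel SchemeOver thickening thickeningLift specOver relFrobeniusOver frobeniusTwistOver frobSpec)
open Literature.NumberTheory.DiophantineGeometry (geomResidueField specResidueField)
open Literature.AlgebraicGeometry.RelativeSpec (ActionOver)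
open Literature.AlgebraicGeometry.GroupSchemes
open Literature.AlgebraicGeometry.GroupSchemes.AffineGroupScheme (Alg quotIncl)
open Literature.AlgebraicGeometry.GroupSchemes.GroupSchemeKernel (ker kerι kerLift kerLift_ι kerι_comp isMonHom_kerLift)
open Literature.AlgebraicGeometry.AbelianSchemes Literature.AlgebraicGeometry.AbelianSchemes.AbelianSchemeOver
open Literature.AlgebraicGeometry.AbelianSchemes.AbelianSchemeOver.RingAction
open Literature.AlgebraicGeometry.GroupSchemes.BTGroup Literature.AlgebraicGeometry.GroupSchemes.BTGroup.Hom
open Literature.AlgebraicGeometry.GroupSchemes.IsRingActionBT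
open Literature.AlgebraicGeometry.HodgeTheory Literature.AlgebraicGeometry.HodgeTheory.RingAction
open Literature.RingTheory.DedekindDomain
open Summit.HodgeConjecture.HodgeConjecture.Cruxes.HLiu418.F0P6aModuliDatumDefs
open Summit.HodgeConjecture.HodgeConjecture.Cruxes.HLiu418.F0P6aRGDAssembly
open Summit.HodgeConjecture.HodgeConjecture.Cruxes.HLiu418.F0P6aDatumOfInputs
variable {F : Type} [Field F] [NumberField F] [IsCMField F] [IsGalois ℚ F] {ι₁ : F →+* ℂ}
    {Jstar : Matrix (Fin 2) (Fin 2) F}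
    {K₀ : C5.OpenCompactSubgroup ↥(finAdelic ↥(maximalRealSubfield F) F (IsCMField.complexConj F) 2 Jstar)}
    {S : RecordSystemGS F Jstar ι₁ K₀} {hU7ₛ : S.HeckeTranslateDefinedOver}
    {hJ : (Jstar.map (IsCMField.complexConj F))ᵀ = Jstar} {hJu : IsUnit Jstar}
    {Fi : Type} [Field Fi] [Algebra F Fi] {Kc : C5.SmallLevel K₀} {G : Type} [Group G]
    {𝓜 : IntegralModel (𝓞 F) F ((thickening F Fi).obj (S.M.obj Kc))}
    {w : HeightOneSpectrum (𝓞 F)} {hw : (IsCMField.complexConj F) • w ≠ w} {h𝓨 : (𝓜.localise w).IsSmoothProper 1}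
    {θ : ActionOver (𝓜.localise w).total.hom ((Fi ≃ₐ[F] Fi) × G)}
    {e : Fi →ₐ[F] AlgebraicClosure (w.adicCompletion F)}
variable (I : RGDInputsAt F ι₁ Jstar K₀ S hU7ₛ hJ hJu Fi Kc G 𝓜 w hw h𝓨 θ e)
section Squeeze
open Literature.AlgebraicGeometry.GroupSchemes.IdealTorsionCoprimeSplitting (comp_comp_eq_one_of_exists_comp_eq finrank_alg_eq_of_squeeze finrank_alg_eq_of_squeeze')
-- ── tree bytes :383–:564 ──

variable [ExpChar (geomResidueField w) I.pChar]

/-- **§6a `finrank_readings_of_kill_sch₀Of`** — THE TWO COUNTS (k2b) ∕ (k2b′) AT THE DOCK.  Inputs: `q̄`, `hr4`, `hkerq`, `hfin`, `hrkK` as in §2 ∕ §6; ANY member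
`H : SubOf I 𝔡 x̄` of the dock carrier (an admissible ideal of `Γ(G₀(x̄))`: its `IsAdm` row carries `dim_κ̄ Γ(G₀(x̄)) ⧸ H = q` — e.g. `spGeoOf I 𝔡 y L` or `kerFOf I 𝔡 x̄`)
which is (KILL)ed: `quotIncl (G₀ x̄) H ≫ ι₀G ≫ q̄ = 1` (LA1-p01 (g3) (ρ1𝒞) §B clause (KILL), tautological currency); and the `w`-SIDE WITNESS (CL-w) «a closed `ν : V ↪ A_x̄` whose
points are `𝔭_w`-torsion and `q̄`-killed, with `q ≤ dim_κ̄ Γ(V)`» (the flat closure of `K ∩ A_y[𝔭_w]`, LA1-p02 ∕ LA1-p01 lineage; LA3-plan (g2) 08:18:46Z shape VERBATIM).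
OUTPUT: every monomorphism into `A_x̄` reading «`𝔭_{c•w}`-torsion ∧ `q̄`-killed» has rank `q` (the `hRK` of §3 at `n := q`, the `hrkcw` of §2) AND every monomorphism reading
«`𝔭_w`-torsion ∧ `q̄`-killed» has rank `q` (= §2's CONCLUSION `hrkN`, now without `hrkcw`).  PROOF: §6 with `V_{c•w} := Spec (Γ(G₀) ⧸ H) ↪ G₀ ↪ A_x̄` (closed: ★
`isClosedImmersion_quotIncl_left`, dock row `hι₀G`; `𝔭_{c•w}`-torsion by the dock row `hkerG₀`; `q̄`-killed by (KILL); rank `q` by ★ `FrobKillEt.finrank_alg_specOver_quotient` and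
`H`'s `IsAdm` row) and `V_w :=` (CL-w). [cite: Tate1997FiniteFlatGroupSchemes, §(3.7) (p. 146)] [cite: Liu2021, Appendix D, Prop. D.8 (3) (p. 137)] -/
theorem finrank_readings_of_kill_sch₀Of (𝔡 : ∀ xbar, DockAt I xbar) (xbar : AlgPoints (𝓜.localise w).reductionAt (geomResidueField w))
    {Bbar : AbelianSchemeOver (Spec (.of (geomResidueField w)))} (qbar : (sch₀Of 𝓜 w I.univ xbar).X ⟶ Bbar.X) [IsMonHom qbar]
    (hr4 : ∀ a : 𝓞 F, ∃ b : Bbar.X ⟶ Bbar.X, (act₀Of 𝓜 w I.univ I.act a xbar).hom.hom.hom ≫ qbar = qbar ≫ b)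
    (hkerq : ∀ ⦃T : SchemeOver (geomResidueField w)⦄ (z : T ⟶ (sch₀Of 𝓜 w I.univ xbar).X), z ≫ qbar = 1 →
      ∀ b ∈ w.asIdeal * ((IsCMField.complexConj F) • w).asIdeal, z ≫ (act₀Of 𝓜 w I.univ I.act b xbar).hom.hom.hom = 1)
    (hfin : IsFinite qbar.left)
    (hrkK : Module.finrank (geomResidueField w) (Alg (ker qbar)) = I.pChar ^ I.fDeg * I.pChar ^ I.fDeg)
    (H : SubOf I 𝔡 xbar)
    (hkill : haveI := (𝔡 xbar).aff₀; quotIncl (𝔡 xbar).G₀ H.1 ≫ (𝔡 xbar).ι₀G ≫ qbar = 1)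
    (hclw : ∃ (V : SchemeOver (geomResidueField w)) (ν : V ⟶ (sch₀Of 𝓜 w I.univ xbar).X), IsClosedImmersion ν.left ∧
      (∀ ⦃T : SchemeOver (geomResidueField w)⦄ (t : T ⟶ (sch₀Of 𝓜 w I.univ xbar).X), (∃ s : T ⟶ V, s ≫ ν = t) →
        (∀ r ∈ w.asIdeal, t ≫ (act₀Of 𝓜 w I.univ I.act r xbar).hom.hom.hom = 1) ∧ t ≫ qbar = 1) ∧
      I.pChar ^ I.fDeg ≤ Module.finrank (geomResidueField w) (Alg V)) :
    (∀ {Z' : SchemeOver (geomResidueField w)} (ζ' : Z' ⟶ (sch₀Of 𝓜 w I.univ xbar).X) [Mono ζ'],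
      (∀ ⦃T : SchemeOver (geomResidueField w)⦄ (x : T ⟶ (sch₀Of 𝓜 w I.univ xbar).X),
        (∃ z : T ⟶ Z', z ≫ ζ' = x) ↔
          (∀ r ∈ ((IsCMField.complexConj F) • w).asIdeal, x ≫ (act₀Of 𝓜 w I.univ I.act r xbar).hom.hom.hom = 1) ∧ x ≫ qbar = 1) →
      Module.finrank (geomResidueField w) (Alg Z') = I.pChar ^ I.fDeg) ∧
    (∀ {Z : SchemeOver (geomResidueField w)} (ζ : Z ⟶ (sch₀Of 𝓜 w I.univ xbar).X) [Mono ζ],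
      (∀ ⦃T : SchemeOver (geomResidueField w)⦄ (x : T ⟶ (sch₀Of 𝓜 w I.univ xbar).X),
        (∃ z : T ⟶ Z, z ≫ ζ = x) ↔ (∀ r ∈ w.asIdeal, x ≫ (act₀Of 𝓜 w I.univ I.act r xbar).hom.hom.hom = 1) ∧ x ≫ qbar = 1) →
      Module.finrank (geomResidueField w) (Alg Z) = I.pChar ^ I.fDeg) := by
  letI := (𝔡 xbar).grp₀
  haveI := (𝔡 xbar).aff₀
  haveI : IsClosedImmersion (𝔡 xbar).ι₀G.left := (𝔡 xbar).hι₀G.2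
  haveI : IsClosedImmersion (quotIncl (𝔡 xbar).G₀ H.1).left := AffineGroupScheme.isClosedImmersion_quotIncl_left (𝔡 xbar).G₀ H.1
  obtain ⟨Vw, νw, hνw, hVw, hqw⟩ := hclw
  -- the `c•w`-side witness `V(H) ↪ G₀ ↪ A_x̄`: closed (no `rw` across the carriers — term-mode composition of the two closed immersions)
  have hci : IsClosedImmersion (quotIncl (𝔡 xbar).G₀ H.1 ≫ (𝔡 xbar).ι₀G).left :=
    IsClosedImmersion.comp (quotIncl (𝔡 xbar).G₀ H.1).left (𝔡 xbar).ι₀G.left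
  -- its points are `𝔭_{c•w}`-torsion (dock row `hkerG₀`) and `q̄`-killed ((KILL), reassociated by `reassoc_of%`)
  have hV : ∀ ⦃T : SchemeOver (geomResidueField w)⦄ (x : T ⟶ (sch₀Of 𝓜 w I.univ xbar).X),
      (∃ s : T ⟶ specOver (geomResidueField w) (Alg (𝔡 xbar).G₀ ⧸ H.1), s ≫ (quotIncl (𝔡 xbar).G₀ H.1 ≫ (𝔡 xbar).ι₀G) = x) →
      (∀ r ∈ ((IsCMField.complexConj F) • w).asIdeal, x ≫ (act₀Of 𝓜 w I.univ I.act r xbar).hom.hom.hom = 1) ∧ x ≫ qbar = 1 := by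
    rintro T x ⟨s, rfl⟩
    refine ⟨((𝔡 xbar).hkerG₀ _).2 ⟨s ≫ quotIncl (𝔡 xbar).G₀ H.1, Category.assoc _ _ _⟩, ?_⟩
    have h := congrArg (fun φ => s ≫ φ) hkill
    simpa only [Category.assoc, MonObj.comp_one] using h
  have hq : I.pChar ^ I.fDeg ≤ Module.finrank (geomResidueField w) (Alg (specOver (geomResidueField w) (Alg (𝔡 xbar).G₀ ⧸ H.1))) := by
    rw [Literature.AlgebraicGeometry.GroupSchemes.FrobKillEt.finrank_alg_specOver_quotient (𝔡 xbar).G₀ H.1]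
    exact H.2.2.1.ge
  exact finrank_readings_of_squeeze_sch₀Of I xbar qbar hr4 hkerq hfin hrkK _ hci hV hq νw hνw hVw hqw

/-- **§6b `finrank_dockReading_of_kill_sch₀Of`** — (k2b) IN THE DOCK-READING CURRENCY of (ρ1𝒞) §B (LA1-p01 (g3)): under the inputs of §6a, every monomorphism `ζ : Z ↪ G₀(x̄)`
reading «`t ≫ ι₀G ≫ q̄ = 1`» has `dim_κ̄ Γ(Z) = q` (§3 `finrank_dockReading_eq_of_cwReading` ∘ §6a.1).  With (KILL) «`V(H) ⊆ Ker q̄ ∩ G₀`» and `dim Γ(G₀) ⧸ H = q` this is the rank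
input of ★ `KernelRecognitionByRank` for (DOCK) «`Ker q̄ ∩ G₀ = V(H)`». [cite: Tate1997FiniteFlatGroupSchemes, §(3.7) (p. 146)] [cite: Liu2021, Appendix D, Prop. D.8 (3) (p. 137)] -/
theorem finrank_dockReading_of_kill_sch₀Of (𝔡 : ∀ xbar, DockAt I xbar) (xbar : AlgPoints (𝓜.localise w).reductionAt (geomResidueField w))
    {Bbar : AbelianSchemeOver (Spec (.of (geomResidueField w)))} (qbar : (sch₀Of 𝓜 w I.univ xbar).X ⟶ Bbar.X) [IsMonHom qbar]
    (hr4 : ∀ a : 𝓞 F, ∃ b : Bbar.X ⟶ Bbar.X, (act₀Of 𝓜 w I.univ I.act a xbar).hom.hom.hom ≫ qbar = qbar ≫ b)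
    (hkerq : ∀ ⦃T : SchemeOver (geomResidueField w)⦄ (z : T ⟶ (sch₀Of 𝓜 w I.univ xbar).X), z ≫ qbar = 1 →
      ∀ b ∈ w.asIdeal * ((IsCMField.complexConj F) • w).asIdeal, z ≫ (act₀Of 𝓜 w I.univ I.act b xbar).hom.hom.hom = 1)
    (hfin : IsFinite qbar.left)
    (hrkK : Module.finrank (geomResidueField w) (Alg (ker qbar)) = I.pChar ^ I.fDeg * I.pChar ^ I.fDeg)
    (H : SubOf I 𝔡 xbar)
    (hkill : haveI := (𝔡 xbar).aff₀; quotIncl (𝔡 xbar).G₀ H.1 ≫ (𝔡 xbar).ι₀G ≫ qbar = 1)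
    (hclw : ∃ (V : SchemeOver (geomResidueField w)) (ν : V ⟶ (sch₀Of 𝓜 w I.univ xbar).X), IsClosedImmersion ν.left ∧
      (∀ ⦃T : SchemeOver (geomResidueField w)⦄ (t : T ⟶ (sch₀Of 𝓜 w I.univ xbar).X), (∃ s : T ⟶ V, s ≫ ν = t) →
        (∀ r ∈ w.asIdeal, t ≫ (act₀Of 𝓜 w I.univ I.act r xbar).hom.hom.hom = 1) ∧ t ≫ qbar = 1) ∧
      I.pChar ^ I.fDeg ≤ Module.finrank (geomResidueField w) (Alg V)) :
    ∀ {Z : SchemeOver (geomResidueField w)} (ζ : Z ⟶ (𝔡 xbar).G₀) [Mono ζ],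
      (∀ ⦃T : SchemeOver (geomResidueField w)⦄ (t : T ⟶ (𝔡 xbar).G₀), (∃ z : T ⟶ Z, z ≫ ζ = t) ↔ t ≫ (𝔡 xbar).ι₀G ≫ qbar = 1) →
      Module.finrank (geomResidueField w) (Alg Z) = I.pChar ^ I.fDeg :=
  finrank_dockReading_eq_of_cwReading I 𝔡 xbar qbar (finrank_readings_of_kill_sch₀Of I 𝔡 xbar qbar hr4 hkerq hfin hrkK H hkill hclw).1

set_option maxHeartbeats 400000 in
/-- **§6c `finrank_alg_ker_ι₀G_comp_of_kill_sch₀Of`** — (k2b) IN THE KERNEL CURRENCY: `dim_κ̄ Γ(Ker (ι₀G ≫ q̄)) = q` («`rk Γ(Ker q̄ ∩ G₀(x̄)) = q`»; §6b at the realisation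
`ι_{Ker (ι₀G ≫ q̄)}`, whose `T`-points are the `t` with `t ≫ ι₀G ≫ q̄ = 1`, ★ `kerLift`). [cite: Tate1997FiniteFlatGroupSchemes, §(3.7) (p. 146)] [cite: Liu2021, Appendix D, Prop. D.8 (3) (p. 137)] -/
theorem finrank_alg_ker_ι₀G_comp_of_kill_sch₀Of (𝔡 : ∀ xbar, DockAt I xbar) (xbar : AlgPoints (𝓜.localise w).reductionAt (geomResidueField w))
    {Bbar : AbelianSchemeOver (Spec (.of (geomResidueField w)))} (qbar : (sch₀Of 𝓜 w I.univ xbar).X ⟶ Bbar.X) [IsMonHom qbar]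
    (hr4 : ∀ a : 𝓞 F, ∃ b : Bbar.X ⟶ Bbar.X, (act₀Of 𝓜 w I.univ I.act a xbar).hom.hom.hom ≫ qbar = qbar ≫ b)
    (hkerq : ∀ ⦃T : SchemeOver (geomResidueField w)⦄ (z : T ⟶ (sch₀Of 𝓜 w I.univ xbar).X), z ≫ qbar = 1 →
      ∀ b ∈ w.asIdeal * ((IsCMField.complexConj F) • w).asIdeal, z ≫ (act₀Of 𝓜 w I.univ I.act b xbar).hom.hom.hom = 1)
    (hfin : IsFinite qbar.left)
    (hrkK : Module.finrank (geomResidueField w) (Alg (ker qbar)) = I.pChar ^ I.fDeg * I.pChar ^ I.fDeg)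
    (H : SubOf I 𝔡 xbar)
    (hkill : haveI := (𝔡 xbar).aff₀; quotIncl (𝔡 xbar).G₀ H.1 ≫ (𝔡 xbar).ι₀G ≫ qbar = 1)
    (hclw : ∃ (V : SchemeOver (geomResidueField w)) (ν : V ⟶ (sch₀Of 𝓜 w I.univ xbar).X), IsClosedImmersion ν.left ∧
      (∀ ⦃T : SchemeOver (geomResidueField w)⦄ (t : T ⟶ (sch₀Of 𝓜 w I.univ xbar).X), (∃ s : T ⟶ V, s ≫ ν = t) →
        (∀ r ∈ w.asIdeal, t ≫ (act₀Of 𝓜 w I.univ I.act r xbar).hom.hom.hom = 1) ∧ t ≫ qbar = 1) ∧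
      I.pChar ^ I.fDeg ≤ Module.finrank (geomResidueField w) (Alg V)) :
    letI := (𝔡 xbar).grp₀
    Module.finrank (geomResidueField w) (Alg (ker ((𝔡 xbar).ι₀G ≫ qbar))) = I.pChar ^ I.fDeg := by
  letI := (𝔡 xbar).grp₀
  haveI := GroupSchemeKernel.mono_kerι ((𝔡 xbar).ι₀G ≫ qbar)
  refine finrank_dockReading_of_kill_sch₀Of I 𝔡 xbar qbar hr4 hkerq hfin hrkK H hkill hclw (kerι ((𝔡 xbar).ι₀G ≫ qbar)) fun T t => ⟨?_, fun ht => ?_⟩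
  · rintro ⟨z, rfl⟩
    rw [Category.assoc, kerι_comp, MonObj.comp_one]
  · exact ⟨kerLift t ht, kerLift_ι t ht⟩

end Squeeze

/-! ## §7 (DOCK) RECOGNITION AT THE DOCK: `Ker q̄ ∩ G₀(x̄) = V(H)` on all `T`-points, from (KILL) and the two ranks `q`
(★ `AffineGroupScheme.isIso_of_isClosedImmersion_of_finrank_alg_eq`; LA3-plan (g2) 09:04:09Z: §B's (DOCK) recognition row; LA3-p03 (g4)) -/

section Dock

variable [ExpChar (geomResidueField w) I.pChar]

/-- Generic helper (variables only, so that no rewriting happens at the D-line carriers): if `u ≫ m = c` with `c.left` a closed immersion and `m` a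
monomorphism (hence `m.left` separated), then `u.left` is a closed immersion (Mathlib `IsClosedImmersion.of_comp`). [cite: GortzWedhorn2020, Definition 4.45 (2) (p. 117)] -/
theorem isClosedImmersion_left_of_comp_eq {S : Scheme} {X Y Z : Over S} (u : X ⟶ Y) (m : Y ⟶ Z) {c : X ⟶ Z}
    (h : u ≫ m = c) [IsClosedImmersion c.left] [Mono m] : IsClosedImmersion u.left := by
  subst h
  haveI : IsClosedImmersion (u.left ≫ m.left) := by rw [← Over.comp_left]; infer_instance
  exact IsClosedImmersion.of_comp u.left m.left

/-- **§7 `comp_ι₀G_comp_eq_one_iff_of_kill_sch₀Of`** — (DOCK) «`Ker q̄ ∩ G₀(x̄) = V(H)`»: under the inputs of §6a (`q̄`, `hr4`, `hkerq`, `hfin`, `hrkK`, an admissible `H` with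
(KILL) `quotIncl (G₀ x̄) H ≫ ι₀G ≫ q̄ = 1`, and the `w`-side witness (CL-w)), a `T`-point `t` of the dock `G₀(x̄)` satisfies `t ≫ ι₀G ≫ q̄ = 1` IFF it factors through
`V(H) = Spec (Γ(G₀) ⧸ H) ↪ G₀`.  PROOF: (KILL) gives the comparison `u := kerLift (quotIncl H) : V(H) ⟶ Ker (ι₀G ≫ q̄)` over `G₀`, a closed immersion (`quotIncl` is one,
`ι_{Ker}` is separated — Mathlib `IsClosedImmersion.of_comp`) between affine `κ̄`-schemes with finite algebras of the SAME dimension `q` (`H` admissible: `dim Γ(G₀) ⧸ H = q`,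
★ `FrobKillEt.finrank_alg_specOver_quotient`; §6c: `dim Γ(Ker (ι₀G ≫ q̄)) = q`), hence an ISOMORPHISM (★ `isIso_of_isClosedImmersion_of_finrank_alg_eq`); so every
`q̄`-killed point `t = kerLift t ≫ ι_{Ker} = (kerLift t ≫ u⁻¹) ≫ quotIncl H`.  At `H := spGeoOf I 𝔡 y L` (LA1-p01 (g3) (ρ1𝒞) (KILL)) and under the GUARD `spGeoOf = kerFOf` this is
W5's `HoleDock` verbatim. [cite: Tate1997FiniteFlatGroupSchemes, §(3.7) (p. 146)] [cite: GortzWedhorn2020, Definition 4.45 (2) (p. 117)] [cite: Liu2021, Appendix D, Prop. D.8 (3) (p. 137)] -/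
theorem comp_ι₀G_comp_eq_one_iff_of_kill_sch₀Of (𝔡 : ∀ xbar, DockAt I xbar) (xbar : AlgPoints (𝓜.localise w).reductionAt (geomResidueField w))
    {Bbar : AbelianSchemeOver (Spec (.of (geomResidueField w)))} (qbar : (sch₀Of 𝓜 w I.univ xbar).X ⟶ Bbar.X) [IsMonHom qbar]
    (hr4 : ∀ a : 𝓞 F, ∃ b : Bbar.X ⟶ Bbar.X, (act₀Of 𝓜 w I.univ I.act a xbar).hom.hom.hom ≫ qbar = qbar ≫ b)
    (hkerq : ∀ ⦃T : SchemeOver (geomResidueField w)⦄ (z : T ⟶ (sch₀Of 𝓜 w I.univ xbar).X), z ≫ qbar = 1 →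
      ∀ b ∈ w.asIdeal * ((IsCMField.complexConj F) • w).asIdeal, z ≫ (act₀Of 𝓜 w I.univ I.act b xbar).hom.hom.hom = 1)
    (hfin : IsFinite qbar.left)
    (hrkK : Module.finrank (geomResidueField w) (Alg (ker qbar)) = I.pChar ^ I.fDeg * I.pChar ^ I.fDeg)
    (H : SubOf I 𝔡 xbar)
    (hkill : haveI := (𝔡 xbar).aff₀; quotIncl (𝔡 xbar).G₀ H.1 ≫ (𝔡 xbar).ι₀G ≫ qbar = 1)
    (hclw : ∃ (V : SchemeOver (geomResidueField w)) (ν : V ⟶ (sch₀Of 𝓜 w I.univ xbar).X), IsClosedImmersion ν.left ∧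
      (∀ ⦃T : SchemeOver (geomResidueField w)⦄ (t : T ⟶ (sch₀Of 𝓜 w I.univ xbar).X), (∃ s : T ⟶ V, s ≫ ν = t) →
        (∀ r ∈ w.asIdeal, t ≫ (act₀Of 𝓜 w I.univ I.act r xbar).hom.hom.hom = 1) ∧ t ≫ qbar = 1) ∧
      I.pChar ^ I.fDeg ≤ Module.finrank (geomResidueField w) (Alg V))
    ⦃T : SchemeOver (geomResidueField w)⦄ (t : T ⟶ (𝔡 xbar).G₀) :
    haveI := (𝔡 xbar).aff₀
    t ≫ (𝔡 xbar).ι₀G ≫ qbar = 1 ↔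
      ∃ s : T ⟶ specOver (geomResidueField w) (Alg (𝔡 xbar).G₀ ⧸ H.1), s ≫ quotIncl (𝔡 xbar).G₀ H.1 = t := by
  letI := (𝔡 xbar).grp₀
  haveI := (𝔡 xbar).aff₀
  haveI := GroupSchemeKernel.mono_kerι ((𝔡 xbar).ι₀G ≫ qbar)
  -- `Ker (ι₀G ≫ q̄) ↪ G₀` is closed (the abelian scheme `B̄` is separated), hence affine; its algebra has dimension `q` (§6c), so is finite
  haveI : IsSeparated Bbar.X.hom := AbelianSchemeOver.isSeparated_hom Bbar
  haveI : IsClosedImmersion (kerι ((𝔡 xbar).ι₀G ≫ qbar)).left := GroupSchemeKernel.isClosedImmersion_kerι_left_of_isSeparated _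
  haveI : IsAffine (ker ((𝔡 xbar).ι₀G ≫ qbar)).left := AffineGroupScheme.isAffine_left_of_isClosedImmersion (kerι ((𝔡 xbar).ι₀G ≫ qbar))
  have hrk : Module.finrank (geomResidueField w) (Alg (ker ((𝔡 xbar).ι₀G ≫ qbar))) = I.pChar ^ I.fDeg :=
    finrank_alg_ker_ι₀G_comp_of_kill_sch₀Of I 𝔡 xbar qbar hr4 hkerq hfin hrkK H hkill hclw
  haveI : Module.Finite (geomResidueField w) (Alg (ker ((𝔡 xbar).ι₀G ≫ qbar))) :=
    Module.finite_of_finrank_pos (by rw [hrk]; exact pow_pos I.hpChar.1.pos _)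
  -- `V(H)` is affine with finite algebra (finite over `κ̄`: dock row `fin₀`)
  haveI : IsAffine (specOver (geomResidueField w) (Alg (𝔡 xbar).G₀ ⧸ H.1)).left :=
    Literature.AlgebraicGeometry.GroupSchemes.FrobKillEt.isAffine_specOver_quotient_left (𝔡 xbar).G₀ H.1
  haveI : IsFinite (𝔡 xbar).G₀.hom := (𝔡 xbar).fin₀
  haveI : IsFinite (specOver (geomResidueField w) (Alg (𝔡 xbar).G₀ ⧸ H.1)).hom :=
    Literature.AlgebraicGeometry.GroupSchemes.FrobKillEt.isFinite_specOver_quotient_hom (𝔡 xbar).G₀ H.1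
  haveI : Module.Finite (geomResidueField w) (Alg (specOver (geomResidueField w) (Alg (𝔡 xbar).G₀ ⧸ H.1))) :=
    AffineGroupScheme.Alg.moduleFinite _
  -- (KILL): the comparison `u : V(H) ⟶ Ker (ι₀G ≫ q̄)` over `G₀`, a closed immersion of equal ranks, hence an isomorphism
  have hu : kerLift (f := (𝔡 xbar).ι₀G ≫ qbar) (quotIncl (𝔡 xbar).G₀ H.1) hkill ≫ kerι ((𝔡 xbar).ι₀G ≫ qbar) = quotIncl (𝔡 xbar).G₀ H.1 :=
    kerLift_ι _ _
  haveI : IsClosedImmersion (quotIncl (𝔡 xbar).G₀ H.1).left := AffineGroupScheme.isClosedImmersion_quotIncl_left (𝔡 xbar).G₀ H.1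
  haveI : IsClosedImmersion (kerLift (f := (𝔡 xbar).ι₀G ≫ qbar) (quotIncl (𝔡 xbar).G₀ H.1) hkill).left :=
    isClosedImmersion_left_of_comp_eq _ _ hu
  haveI : IsIso (kerLift (f := (𝔡 xbar).ι₀G ≫ qbar) (quotIncl (𝔡 xbar).G₀ H.1) hkill) :=
    AffineGroupScheme.isIso_of_isClosedImmersion_of_finrank_alg_eq _
      ((Literature.AlgebraicGeometry.GroupSchemes.FrobKillEt.finrank_alg_specOver_quotient (𝔡 xbar).G₀ H.1).trans (H.2.2.1.trans hrk.symm))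
  have hinv : inv (kerLift (f := (𝔡 xbar).ι₀G ≫ qbar) (quotIncl (𝔡 xbar).G₀ H.1) hkill) ≫ quotIncl (𝔡 xbar).G₀ H.1 =
      kerι ((𝔡 xbar).ι₀G ≫ qbar) := (IsIso.inv_comp_eq _).2 hu.symm
  constructor
  · intro ht
    exact ⟨kerLift t ht ≫ inv (kerLift (f := (𝔡 xbar).ι₀G ≫ qbar) (quotIncl (𝔡 xbar).G₀ H.1) hkill),
      (Category.assoc _ _ _).trans (((congrArg (fun φ => kerLift t ht ≫ φ) hinv)).trans (kerLift_ι t ht))⟩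
  · rintro ⟨s, rfl⟩
    have h := congrArg (fun φ => s ≫ φ) hkill
    simpa only [Category.assoc, MonObj.comp_one] using h

end Dock

end Summit.HodgeConjecture.HodgeConjecture.Cruxes.HLiu418.F0P6aRoofWCounts

end
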